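import Summits.MatrixMultiplication.MatrixMultiplication.Theorems.LevelGradedCohnUmansLevelOneGL2DesignsTangencyPlaneUnital

/-!
# The tangents of a unital form a dual unital — stub `stub_tangencySets` (crux `LevelOneGL2Designs`,
stmt-MatrixMultiplication-14080), wall-breaker axis 10/12 "Hermitian unital constructions", generation 1
(seat 3), part 4 (duality)

Part 1 (`…TangencyPlaneUnital`): a strong representative system `S` (flags `(pᵢ, ℓᵢ)`, `pᵢ ∈ ℓⱼ ↔ i = j`)
of a projective plane of order `n` with `(|S| − 1)² = n³` has `n = r²` and a unital as point set, every
non-designated LINE being an `(r+1)`-secant.  The defining condition of an SRS is self-dual, so the same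
theorem read in the dual plane (Mathlib's `Configuration.Dual`, same order) gives the dual half of the
classical picture:

* `srs_dual` — the swapped flags form a strong representative system of the dual plane;
* `srs_extremal_dual_structure` — in the extremal case every POINT off the unital lies on exactly `r + 1`
  of the `r³ + 1` designated tangents (points of the unital lie on exactly one,
  `PlaneUnital.srs_extremal_tangent_unique`): the tangents form a unital of the dual plane — for the
  classical unital of `PG(2,q²)` this is the familiar fact that the `q + 1` tangents through an external
  point touch it in the points of a Baer subline (its polar), and that the dual of a Hermitian curve is a
  Hermitian curve.

Reading for the stub: the extremal configuration the axis is built on is rigid on both sides of the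
incidence, in every finite projective plane; neither side is available in prime order.
[classical; Barwick–Ebert, *Unitals in projective planes* (2008), Ch. 1–2].  Imports part 1 only; no
definitions.
-/

-- `Summit.MatrixMultiplication.MatrixMultiplication.…` is the tree's mandated summit/problem namespace (D-0017).
set_option linter.dupNamespace false

namespace Summit.MatrixMultiplication.MatrixMultiplication.Theorems.LevelOneGL2Designs.PlaneUnital

open Finset Configuration

variable {P L : Type*} [Membership P L] [Configuration.ProjectivePlane P L] [Fintype P] [Fintype L]

/-! ## Duality: the designated tangents of an extremal system form a unital of the dual plane -/

omit [Configuration.ProjectivePlane P L] [Fintype P] [Fintype L] in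
open scoped Classical in
/-- **The dual of a strong representative system.**  Swapping the flags of a strong representative
system of `(P, L)` gives one of the dual plane `(Dual L, Dual P)` (Mathlib's `Configuration.Dual`):
the condition `pᵢ ∈ ℓⱼ ↔ i = j` is self-dual. [elementary] -/
theorem srs_dual (S : Finset (P × L)) (hS : ∀ f ∈ S, ∀ g ∈ S, (f.1 ∈ g.2 ↔ f = g)) :
    ∀ f ∈ (S.image Prod.swap : Finset (Configuration.Dual L × Configuration.Dual P)),
      ∀ g ∈ (S.image Prod.swap : Finset (Configuration.Dual L × Configuration.Dual P)),
        (f.1 ∈ g.2 ↔ f = g) := by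
  intro f hf g hg
  obtain ⟨f₀, hf₀, rfl⟩ := Finset.mem_image.mp hf
  obtain ⟨g₀, hg₀, rfl⟩ := Finset.mem_image.mp hg
  change @Membership.mem P L _ f₀.2 g₀.1 ↔ _
  rw [hS g₀ hg₀ f₀ hf₀]
  constructor
  · rintro rfl
    rfl
  · intro h
    exact (Prod.swap_injective h).symm

open scoped Classical in
/-- **The tangents of a unital form a dual unital.**  If a strong representative system `S` of a plane
of order `n` attains `(|S| − 1)² = n³` (so `n = r²` and its point set `V` is a unital,
`srs_extremal_structure`), then every point of the plane OFF `V` lies on exactly `r + 1` of the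
designated tangent lines (and every point of `V` on exactly one): the `r³ + 1` tangents form a unital of
the dual plane.  Proof: apply `srs_extremal_structure` to the dual system `srs_dual`.
[classical; e.g. Barwick–Ebert, *Unitals in projective planes*, Ch. 1] -/
theorem srs_extremal_dual_structure (S : Finset (P × L))
    (hS : ∀ f ∈ S, ∀ g ∈ S, (f.1 ∈ g.2 ↔ f = g))
    (heq : (S.card - 1) ^ 2 = ProjectivePlane.order P L ^ 3) :
    ∃ r : ℕ, ProjectivePlane.order P L = r ^ 2 ∧ S.card = r ^ 3 + 1 ∧
      ∀ q : P, q ∉ S.image Prod.fst → (S.filter fun f => q ∈ f.2).card = r + 1 := by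
  set S' : Finset (Configuration.Dual L × Configuration.Dual P) := S.image Prod.swap with hS'_def
  have hS' := srs_dual S hS
  have hcard : S'.card = S.card := Finset.card_image_of_injective _ Prod.swap_injective
  have heq' : (S'.card - 1) ^ 2 = ProjectivePlane.order (Configuration.Dual L) (Configuration.Dual P) ^ 3 := by
    rw [hcard, Configuration.ProjectivePlane.Dual.order]
    exact heq
  obtain ⟨r, hr, hN, hsec⟩ := srs_extremal_structure S' hS' heq'
  rw [Configuration.ProjectivePlane.Dual.order] at hr
  refine ⟨r, hr, hcard ▸ hN, fun q hq => ?_⟩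
  have hq' : (q : Configuration.Dual P) ∉ S'.image Prod.snd := by
    rw [hS'_def, Finset.image_image]
    exact hq
  have h := hsec q hq'
  rw [hS'_def, Finset.filter_image, Finset.card_image_of_injective _ Prod.swap_injective] at h
  exact h

end Summit.MatrixMultiplication.MatrixMultiplication.Theorems.LevelOneGL2Designs.PlaneUnital
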